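import Literature.NumberTheory.ModularForms.PoincareSeriesWeightTwoHecke
import Mathlib.NumberTheory.ModularForms.EisensteinSeries.Summable
import HarnessLib

/-!
# The Hecke-regularised weight-2 Poincaré series of `Γ₀(N)`: absolute convergence for `s > 0` and
# weight-`(2,s)` automorphy (Iwaniec–Kowalski §14.1 (14.4) with Hecke's trick, §3.2)

Topic `Literature/NumberTheory/ModularForms` (namespace `Literature.NumberTheory.ModularForms.PoincareWeightTwo`,
continuing the definitions file `PoincareSeriesWeightTwoHecke.lean`). THEOREMS ONLY (plus the row action
`rowSMul`/`rowSMulEquiv`, definitions with bodies used in the proofs); no named fact.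

For `P_m(z,s) = ½ Σ_{(c,d)=1, N∣c} (cz+d)⁻² |cz+d|^{−2s} e(m γ_{(c,d)} z)` (`poincareHecke N m s z`):

* `norm_poincareTerm_le`, `summable_poincareTerm` — `|term| ≤ |cz+d|^{−(2+2s)}` and **absolute
  convergence for `s > 0`**, by Mathlib's Eisenstein majorant (`EisensteinSeries.summand_bound`,
  `EisensteinSeries.summable_one_div_norm_rpow` with exponent `2 + 2s > 2`).
* `rowSMul`, `rowSMulEquiv` — the right action `v ↦ vγ` of `Γ₀(N)` on the rows (a permutation);
  `rowDenom_smul` — the cocycle `j_v(γz) = j_{vγ}(z)/j_γ(z)`; `exists_eq_T_zpow_mul` — matrices of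
  `SL(2,ℤ)` with equal bottom rows differ by `Tᵏ` on the left; `cexp_rowMatrix_smul` — hence the phase
  `e(mγ_v(γz)) = e(mγ_{vγ}z)` depends only on the row.
* `poincareTerm_smul`, `poincareHecke_smul` — **`P_m(γz,s) = (cz+d)² |cz+d|^{2s} P_m(z,s)`** for
  `γ ∈ Γ₀(N)` (reindexing by `rowSMulEquiv`).
* `heckeConvergence` — the two facts in the exact `∀`-form of the registered stub `stub_heckeConvergence`
  (statement `HeckeConvergence`) of the I1 fact skeleton
  `Summits/Parity/GeneralizedHardyLittlewood/Cruxes/PeterssonBoundPrinted/Lines/poincare_hecke.lean`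
  (Kowalski–Michel 2000, Petersson's formula at prime level and weight 2; stmt-Parity-20404).

## References

* [IwaniecKowalski2004] H. Iwaniec, E. Kowalski, *Analytic Number Theory*, AMS Colloq. Publ. 53,
  §14.1 (14.4) (Poincaré series), §3.2 (Hecke's trick), §14.2.
* [KowalskiMichel2000] E. Kowalski, P. Michel, Acta Arith. 94 (2000), §2.4.2 p. 312.
-/

noncomputable section

open scoped MatrixGroups Real
open CongruenceSubgroup Complex MeasureTheory
open UpperHalfPlane hiding I
open Literature.NumberTheory.EllipticCurves.ModularForms

namespace Literature.NumberTheory.ModularForms.PoincareWeightTwo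


/-! ## Norm of a term and absolute convergence for `s > 0` -/

section Convergence

variable {N : ℕ} [NeZero N]

/-- `Im (γ z) > 0` gives `|e(m γ z)| ≤ 1` for `m ≥ 0`. [cite: IwaniecKowalski2004, §14.1 (14.4)] -/
theorem norm_cexp_two_pi_I_mul_le_one (m : ℕ) (w : ℍ) :
    ‖cexp (2 * π * I * m * (w : ℂ))‖ ≤ 1 := by
  rw [Complex.norm_exp]
  refine Real.exp_le_one_iff.mpr ?_
  have h : (2 * π * I * m * (w : ℂ)).re = -(2 * π * m * w.im) := by
    simp [Complex.mul_re, Complex.mul_im, UpperHalfPlane.coe_im, UpperHalfPlane.coe_re]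
  rw [h, neg_nonpos]
  have := w.im_pos
  positivity

omit [NeZero N] in
/-- **Norm of one term:** `‖(cz+d)⁻²|cz+d|^{−2s} e(mγz)‖ ≤ |cz+d|^{−(2+2s)}`.
[cite: IwaniecKowalski2004, §14.1 (14.4)] -/
theorem norm_poincareTerm_le (m : ℕ) (s : ℝ) (v : Row N) (z : ℍ) :
    ‖poincareTerm N m s v z‖ ≤ ‖rowDenom v.1 z‖ ^ (-(2 + 2 * s)) := by
  have hj : 0 < ‖rowDenom v.1 z‖ := norm_pos_iff.mpr (rowDenom_ne_zero v.1 v.2.1 z)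
  rw [poincareTerm, norm_mul, norm_mul, norm_inv, norm_pow, Complex.norm_real, Real.norm_eq_abs,
    abs_of_nonneg (Real.rpow_nonneg hj.le _)]
  calc (‖rowDenom v.1 z‖ ^ 2)⁻¹ * ‖rowDenom v.1 z‖ ^ (-(2 * s)) *
        ‖cexp (2 * π * I * m * ((rowMatrix v.1 v.2.1 • z : ℍ) : ℂ))‖
      ≤ (‖rowDenom v.1 z‖ ^ 2)⁻¹ * ‖rowDenom v.1 z‖ ^ (-(2 * s)) * 1 := by
        gcongr
        exact norm_cexp_two_pi_I_mul_le_one m _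
    _ = ‖rowDenom v.1 z‖ ^ (-(2 + 2 * s)) := by
        rw [mul_one, ← Real.rpow_natCast, ← Real.rpow_neg hj.le, ← Real.rpow_add hj]
        congr 1
        push_cast
        ring

omit [NeZero N] in
/-- **Absolute convergence of the Hecke-regularised Poincaré series for `s > 0`** (majorant: the
Eisenstein row sums `Σ_{(c,d)} |cz+d|^{−(2+2s)}`, Mathlib `EisensteinSeries.summable_one_div_norm_rpow`
with `summand_bound`). [cite: IwaniecKowalski2004, §14.1 (14.4) with §3.2] -/
theorem summable_poincareTerm (m : ℕ) {s : ℝ} (hs : 0 < s) (z : ℍ) :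
    Summable (fun v : Row N ↦ poincareTerm N m s v z) := by
  have hk : 0 ≤ 2 + 2 * s := by linarith
  have hmaj : Summable fun v : Row N ↦
      EisensteinSeries.r z ^ (-(2 + 2 * s)) * ‖v.1‖ ^ (-(2 + 2 * s)) := by
    have h := (EisensteinSeries.summable_one_div_norm_rpow (by linarith : 2 < 2 + 2 * s)).mul_left
      (EisensteinSeries.r z ^ (-(2 + 2 * s)))
    exact h.subtype _
  refine Summable.of_norm_bounded hmaj fun v ↦ ?_
  refine (norm_poincareTerm_le m s v z).trans ?_
  have h := EisensteinSeries.summand_bound z hk v.1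
  simpa [rowDenom] using h

end Convergence

/-! ## The action of `Γ₀(N)` on rows and the weight-`(2,s)` automorphy -/

section Automorphy

variable {N : ℕ}

/-- Components of a row-times-matrix product `v γ`. [folklore] -/
private theorem vecMul_fin_two (v : Fin 2 → ℤ) (M : Matrix (Fin 2) (Fin 2) ℤ) :
    Matrix.vecMul v M = ![v 0 * M 0 0 + v 1 * M 1 0, v 0 * M 0 1 + v 1 * M 1 1] := by
  funext j
  fin_cases j <;> simp [Matrix.vecMul, dotProduct, Fin.sum_univ_two]

/-- The bottom row of an element of `SL(2, ℤ)` is coprime. [folklore] -/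
private theorem isCoprime_row (g : SL(2, ℤ)) : IsCoprime (g 1 0) (g 1 1) := by
  refine ⟨-(g 0 1), g 0 0, ?_⟩
  have := g.det_coe
  rw [Matrix.det_fin_two] at this
  linear_combination this

/-- **Right action of `Γ₀(N)` on the rows**: `v ↦ vγ` (the bottom row of `γ_v γ`); it preserves
coprimality and `N ∣ c`. [cite: IwaniecKowalski2004, §14.1 (14.4)] -/
def rowSMul (γ : SL(2, ℤ)) (hγ : γ ∈ Gamma0 N) (v : Row N) : Row N :=
  ⟨Matrix.vecMul v.1 (γ : Matrix (Fin 2) (Fin 2) ℤ), by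
    obtain ⟨u, w, huw⟩ := v.2.1
    have hdet := g_det γ
    rw [vecMul_fin_two]
    simp only [Matrix.cons_val_zero, Matrix.cons_val_one]
    exact ⟨u * γ 1 1 - w * γ 0 1, -(u * γ 1 0) + w * γ 0 0, by
      linear_combination (u * v.1 0 + w * v.1 1) * hdet + huw⟩, by
    rw [vecMul_fin_two]
    simp only [Matrix.cons_val_zero]
    have h1 : (N : ℤ) ∣ γ 1 0 := by
      have := Gamma0_mem.mp hγ
      exact (ZMod.intCast_zmod_eq_zero_iff_dvd _ _).mp this
    exact dvd_add (dvd_mul_of_dvd_left v.2.2 _) (dvd_mul_of_dvd_right h1 _)⟩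
where
  /-- `det γ = 1` in the entries. -/
  g_det (γ : SL(2, ℤ)) : γ 0 0 * γ 1 1 - γ 0 1 * γ 1 0 = 1 := by
    have := γ.det_coe
    rwa [Matrix.det_fin_two] at this

/-- The value of `rowSMul`. [cite: IwaniecKowalski2004, §14.1 (14.4)] -/
theorem rowSMul_val (γ : SL(2, ℤ)) (hγ : γ ∈ Gamma0 N) (v : Row N) :
    (rowSMul γ hγ v).1 = Matrix.vecMul v.1 (γ : Matrix (Fin 2) (Fin 2) ℤ) := rfl

/-- `v ↦ vγ` is a permutation of the rows (inverse `v ↦ vγ⁻¹`). [cite: IwaniecKowalski2004, §14.1 (14.4)] -/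
def rowSMulEquiv (γ : SL(2, ℤ)) (hγ : γ ∈ Gamma0 N) : Row N ≃ Row N where
  toFun := rowSMul γ hγ
  invFun := rowSMul γ⁻¹ ((Gamma0 N).inv_mem hγ)
  left_inv v := by
    apply Subtype.ext
    rw [rowSMul_val, rowSMul_val, Matrix.vecMul_vecMul, ← Matrix.SpecialLinearGroup.coe_mul,
      mul_inv_cancel, Matrix.SpecialLinearGroup.coe_one, Matrix.vecMul_one]
  right_inv v := by
    apply Subtype.ext
    rw [rowSMul_val, rowSMul_val, Matrix.vecMul_vecMul, ← Matrix.SpecialLinearGroup.coe_mul,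
      inv_mul_cancel, Matrix.SpecialLinearGroup.coe_one, Matrix.vecMul_one]

/-- `j_v(γz) = j_{vγ}(z) / j_γ(z)` (the cocycle relation on rows). [cite: IwaniecKowalski2004, §14.1 (14.4)] -/
theorem rowDenom_smul (v : Fin 2 → ℤ) (γ : SL(2, ℤ)) (z : ℍ) :
    rowDenom v (γ • z) =
      rowDenom (Matrix.vecMul v (γ : Matrix (Fin 2) (Fin 2) ℤ)) z /
        rowDenom ((γ : Matrix (Fin 2) (Fin 2) ℤ) 1) z := by
  have hJ' : rowDenom ((γ : Matrix (Fin 2) (Fin 2) ℤ) 1) z ≠ 0 :=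
    rowDenom_ne_zero _ (isCoprime_row γ) z
  set J : ℂ := rowDenom ((γ : Matrix (Fin 2) (Fin 2) ℤ) 1) z with hJdef
  have hJ : ((γ 1 0 : ℤ) : ℂ) * (z : ℂ) + ((γ 1 1 : ℤ) : ℂ) = J := by rw [hJdef, rowDenom]
  have hcoe : ((γ • z : ℍ) : ℂ) =
      (((γ 0 0 : ℤ) : ℂ) * z + ((γ 0 1 : ℤ) : ℂ)) / J := by
    rw [UpperHalfPlane.coe_specialLinearGroup_apply, ← hJ]
    simp
  have hnum : rowDenom (Matrix.vecMul v (γ : Matrix (Fin 2) (Fin 2) ℤ)) z =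
      (v 0 : ℂ) * (((γ 0 0 : ℤ) : ℂ) * z + ((γ 0 1 : ℤ) : ℂ)) + (v 1 : ℂ) * J := by
    rw [← hJ, rowDenom, vecMul_fin_two]
    simp only [Matrix.cons_val_zero, Matrix.cons_val_one]
    push_cast
    ring
  rw [hnum, rowDenom, hcoe, eq_div_iff hJ', add_mul, mul_assoc, div_mul_cancel₀ _ hJ']

/-- Two elements of `SL(2, ℤ)` with the same bottom row differ by a power of `T` on the left
(`Γ_∞⁺ = {Tⁿ}` acts simply transitively on the matrices with a given bottom row).
[cite: IwaniecKowalski2004, §14.1 (14.4)] -/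
theorem exists_eq_T_zpow_mul (g h : SL(2, ℤ)) (h0 : g 1 0 = h 1 0) (h1 : g 1 1 = h 1 1) :
    ∃ k : ℤ, g = ModularGroup.T ^ k * h := by
  set u : SL(2, ℤ) := g * h⁻¹ with hu
  have hdet := h.det_coe
  rw [Matrix.det_fin_two] at hdet
  have hgdet := g.det_coe
  rw [Matrix.det_fin_two] at hgdet
  have u10 : u 1 0 = 0 := by
    rw [hu, Matrix.SpecialLinearGroup.coe_mul, Matrix.SpecialLinearGroup.coe_inv,
      Matrix.adjugate_fin_two, Matrix.mul_apply, Fin.sum_univ_two]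
    simp [h0, h1]
    ring
  have u11 : u 1 1 = 1 := by
    rw [hu, Matrix.SpecialLinearGroup.coe_mul, Matrix.SpecialLinearGroup.coe_inv,
      Matrix.adjugate_fin_two, Matrix.mul_apply, Fin.sum_univ_two]
    simp only [Matrix.of_apply, Matrix.cons_val', Matrix.cons_val_one, Matrix.cons_val_fin_one,
      Matrix.cons_val_zero]
    rw [h0, h1]
    linear_combination hdet
  have u00 : u 0 0 = 1 := by
    have := u.det_coe
    rw [Matrix.det_fin_two, u10, u11] at this
    linarith
  refine ⟨u 0 1, ?_⟩
  have hueq : u = ModularGroup.T ^ (u 0 1) := by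
    ext i j
    rw [ModularGroup.coe_T_zpow]
    fin_cases i <;> fin_cases j <;> simp [u00, u10, u11]
  rw [← hueq, hu, inv_mul_cancel_right]

/-- **The phase depends only on the row**: `e(m · γ_v(γz)) = e(m · γ_{vγ} z)` — the matrices
`γ_v γ` and `γ_{vγ}` have the same bottom row, so differ by `Tᵏ`, which shifts `z` by `k ∈ ℤ`.
[cite: IwaniecKowalski2004, §14.1 (14.4)] -/
theorem cexp_rowMatrix_smul (m : ℕ) (γ : SL(2, ℤ)) (hγ : γ ∈ Gamma0 N) (v : Row N) (z : ℍ) :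
    cexp (2 * π * I * m * ((rowMatrix v.1 v.2.1 • γ • z : ℍ) : ℂ)) =
      cexp (2 * π * I * m * ((rowMatrix (rowSMul γ hγ v).1 (rowSMul γ hγ v).2.1 • z : ℍ) : ℂ)) := by
  set g : SL(2, ℤ) := rowMatrix v.1 v.2.1 * γ with hg
  set h : SL(2, ℤ) := rowMatrix (rowSMul γ hγ v).1 (rowSMul γ hγ v).2.1 with hh
  have hrow0 : g 1 0 = h 1 0 := by
    simp only [hg, hh, Matrix.SpecialLinearGroup.coe_mul, Matrix.mul_apply, Fin.sum_univ_two,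
      rowMatrix_apply_one_zero, rowMatrix_apply_one_one, rowSMul_val, vecMul_fin_two,
      Matrix.cons_val_zero]
  have hrow1 : g 1 1 = h 1 1 := by
    simp only [hg, hh, Matrix.SpecialLinearGroup.coe_mul, Matrix.mul_apply, Fin.sum_univ_two,
      rowMatrix_apply_one_zero, rowMatrix_apply_one_one, rowSMul_val, vecMul_fin_two,
      Matrix.cons_val_one, Matrix.cons_val_zero]
  obtain ⟨k, hk⟩ := exists_eq_T_zpow_mul g h hrow0 hrow1
  rw [← mul_smul, ← hg, hk, mul_smul, UpperHalfPlane.modular_T_zpow_smul, UpperHalfPlane.coe_vadd,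
    show 2 * π * I * m * ((((k : ℝ) : ℂ)) + ((h • z : ℍ) : ℂ)) =
      2 * π * I * m * ((h • z : ℍ) : ℂ) + ((m * k : ℤ) : ℂ) * (2 * π * I) by push_cast; ring,
    Complex.exp_add, Complex.exp_int_mul_two_pi_mul_I, mul_one]

/-- **One term at `γz`**: `j_v(γz)⁻²|j_v(γz)|^{−2s} e(mγ_vγz) = j_γ(z)²|j_γ(z)|^{2s} · (term of the row vγ at z)`.
[cite: IwaniecKowalski2004, §14.1 (14.4) with §3.2] -/
theorem poincareTerm_smul (m : ℕ) (s : ℝ) (γ : SL(2, ℤ)) (hγ : γ ∈ Gamma0 N) (v : Row N) (z : ℍ) :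
    poincareTerm N m s v (γ • z) =
      (rowDenom ((γ : Matrix (Fin 2) (Fin 2) ℤ) 1) z) ^ 2 *
        ((‖rowDenom ((γ : Matrix (Fin 2) (Fin 2) ℤ) 1) z‖ ^ (2 * s) : ℝ) : ℂ) *
          poincareTerm N m s (rowSMul γ hγ v) z := by
  have hJ : rowDenom ((γ : Matrix (Fin 2) (Fin 2) ℤ) 1) z ≠ 0 :=
    rowDenom_ne_zero _ (isCoprime_row γ) z
  have hX : rowDenom (rowSMul γ hγ v).1 z ≠ 0 := rowDenom_ne_zero _ (rowSMul γ hγ v).2.1 z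
  have hJn : 0 < ‖rowDenom ((γ : Matrix (Fin 2) (Fin 2) ℤ) 1) z‖ := norm_pos_iff.mpr hJ
  have hXn : 0 < ‖rowDenom (rowSMul γ hγ v).1 z‖ := norm_pos_iff.mpr hX
  have hrel : rowDenom v.1 (γ • z) =
      rowDenom (rowSMul γ hγ v).1 z / rowDenom ((γ : Matrix (Fin 2) (Fin 2) ℤ) 1) z := by
    rw [rowSMul_val, rowDenom_smul]
  unfold poincareTerm
  rw [hrel, cexp_rowMatrix_smul m γ hγ v z, norm_div,
    Real.div_rpow (norm_nonneg _) (norm_nonneg _), Real.rpow_neg hJn.le, Real.rpow_neg hXn.le,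
    div_pow]
  have h1 : (((‖rowDenom ((γ : Matrix (Fin 2) (Fin 2) ℤ) 1) z‖ ^ (2 * s) : ℝ)) : ℂ) ≠ 0 := by
    exact_mod_cast (Real.rpow_pos_of_pos hJn _).ne'
  have h2 : (((‖rowDenom (rowSMul γ hγ v).1 z‖ ^ (2 * s) : ℝ)) : ℂ) ≠ 0 := by
    exact_mod_cast (Real.rpow_pos_of_pos hXn _).ne'
  push_cast
  field_simp

/-- **Weight-`(2,s)` automorphy of the Hecke-regularised Poincaré series**:
`P_m(γz, s) = (cz+d)² |cz+d|^{2s} P_m(z, s)` for `γ = (a b; c d) ∈ Γ₀(N)` (reindex the rows by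
`v ↦ vγ`). [cite: IwaniecKowalski2004, §14.1 (14.4) with §3.2] -/
theorem poincareHecke_smul (m : ℕ) (s : ℝ) (γ : SL(2, ℤ)) (hγ : γ ∈ Gamma0 N) (z : ℍ) :
    poincareHecke N m s (γ • z) =
      (rowDenom ((γ : Matrix (Fin 2) (Fin 2) ℤ) 1) z) ^ 2 *
        ((‖rowDenom ((γ : Matrix (Fin 2) (Fin 2) ℤ) 1) z‖ ^ (2 * s) : ℝ) : ℂ) *
          poincareHecke N m s z := by
  unfold poincareHecke
  have h := (rowSMulEquiv γ hγ).tsum_eq (fun v ↦ poincareTerm N m s v z)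
  simp only [rowSMulEquiv, Equiv.coe_fn_mk] at h
  simp_rw [poincareTerm_smul m s γ hγ _ z]
  rw [tsum_mul_left, h]
  ring

end Automorphy

/-! ## The registered stub statement `HeckeConvergence` -/

/-- **T1 (`HeckeConvergence`) of the I1 skeleton `poincare_hecke`, PROVED**: for `s > 0` the
Hecke-regularised weight-2 Poincaré series of `Γ₀(N)` converges absolutely and satisfies
`P_m(γz,s) = (cz+d)²|cz+d|^{2s}P_m(z,s)` for `γ ∈ Γ₀(N)`. [cite: IwaniecKowalski2004, §14.1 (14.4) with §3.2] -/
theorem heckeConvergence :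
    ∀ (N : ℕ) [NeZero N] (m : ℕ), 1 ≤ m → ∀ (s : ℝ), 0 < s → ∀ z : ℍ,
      Summable (fun v : Row N ↦ poincareTerm N m s v z) ∧
      ∀ γ : SL(2, ℤ), γ ∈ Gamma0 N →
        poincareHecke N m s (γ • z) =
          (rowDenom ((γ : Matrix (Fin 2) (Fin 2) ℤ) 1) z) ^ 2 *
            ((‖rowDenom ((γ : Matrix (Fin 2) (Fin 2) ℤ) 1) z‖ ^ (2 * s) : ℝ) : ℂ) *
              poincareHecke N m s z :=
  fun _ _ m _ s hs z ↦ ⟨summable_poincareTerm m hs z, fun γ hγ ↦ poincareHecke_smul m s γ hγ z⟩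


/-! ## Quantitative companions (appended by seat `ls-inputs-I1-w2`, from its accepted p612129 which
an independent whole-file proposal to the same path superseded): the EXACT size of a term, the
Eisenstein majorant over the rows as a summable family for every real weight `> 2`, the `HasSum`
form of `P_m(z, s)` and a bound uniform in `m` — the handles the Fourier-mode (T2), limit (T3) and
`L²` (T4) stubs of the I1 skeleton need for dominated convergence. -/

section Majorant

variable {N : ℕ}

/-- `|e(m w)| = e^{−2π m Im w}` for `w ∈ ℍ`, `m ∈ ℕ` (equality form of
`norm_cexp_two_pi_I_mul_le_one`). [cite: IwaniecKowalski2004, §14.1 (14.4)] -/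
theorem norm_cexp_two_pi_I_natCast_mul (m : ℕ) (w : ℍ) :
    ‖cexp (2 * π * I * m * (w : ℂ))‖ = Real.exp (-(2 * π * m * w.im)) := by
  rw [Complex.norm_exp]
  congr 1
  simp only [mul_re, mul_im, re_ofNat, im_ofNat, ofReal_re, ofReal_im, Complex.I_re, Complex.I_im,
    natCast_re, natCast_im, UpperHalfPlane.coe_re, UpperHalfPlane.coe_im]
  ring

/-- `|cz + d| > 0` for a coprime row. [cite: IwaniecKowalski2004, §14.1 (14.4)] -/
theorem norm_rowDenom_pos (v : Fin 2 → ℤ) (hv : IsCoprime (v 0) (v 1)) (z : ℍ) :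
    0 < ‖rowDenom v z‖ :=
  norm_pos_iff.mpr (rowDenom_ne_zero v hv z)

/-- **The exact size of one term of `P_m(z, s)`:**
`|(cz+d)⁻² |cz+d|^{−2s} e(m γ_{(c,d)} z)| = |cz+d|^{−(2+2s)} · e^{−2πm Im(γ_{(c,d)} z)}`.
[cite: IwaniecKowalski2004, §14.1 (14.4)–(14.5)] -/
theorem norm_poincareTerm_eq (m : ℕ) (s : ℝ) (v : Row N) (z : ℍ) :
    ‖poincareTerm N m s v z‖ =
      ‖rowDenom v.1 z‖ ^ (-(2 + 2 * s)) *
        Real.exp (-(2 * π * m * (rowMatrix v.1 v.2.1 • z).im)) := by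
  have hd : 0 < ‖rowDenom v.1 z‖ := norm_rowDenom_pos v.1 v.2.1 z
  unfold poincareTerm
  rw [norm_mul, norm_mul, norm_inv, norm_pow, Complex.norm_real,
    Real.norm_of_nonneg (Real.rpow_nonneg (norm_nonneg _) _), norm_cexp_two_pi_I_natCast_mul]
  congr 1
  rw [neg_add, Real.rpow_add hd, Real.rpow_neg hd.le 2, Real.rpow_two]

/-- **The Eisenstein majorant over the rows converges for every real weight `k > 2`:**
`Σ_{(c,d)=1, N∣c} |cz+d|^{−k} < ∞` (Mathlib: `|cz+d| ≥ r(z)·max(|c|,|d|)`, `EisensteinSeries.summand_bound`,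
and `Σ_{(c,d) ∈ ℤ²} max(|c|,|d|)^{−k} < ∞`, `EisensteinSeries.summable_one_div_norm_rpow`).
[cite: IwaniecKowalski2004, §14.1 (absolute convergence for k > 2)] -/
theorem summable_norm_rowDenom_rpow {k : ℝ} (hk : 2 < k) (z : ℍ) :
    Summable fun v : Row N ↦ ‖rowDenom v.1 z‖ ^ (-k) := by
  have h1 : Summable fun x : Fin 2 → ℤ ↦ ‖(x 0 : ℂ) * (z : ℂ) + x 1‖ ^ (-k) :=
    Summable.of_nonneg_of_le (fun x ↦ Real.rpow_nonneg (norm_nonneg _) _)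
      (fun x ↦ EisensteinSeries.summand_bound z (by linarith) x)
      ((EisensteinSeries.summable_one_div_norm_rpow hk).mul_left _)
  exact h1.comp_injective Subtype.val_injective

/-- The series of NORMS `Σ_v |poincareTerm N m s v z|` converges for `s > 0`.
[cite: IwaniecKowalski2004, §14.1 (14.5)] -/
theorem summable_norm_poincareTerm (m : ℕ) {s : ℝ} (hs : 0 < s) (z : ℍ) :
    Summable fun v : Row N ↦ ‖poincareTerm N m s v z‖ :=
  (summable_norm_rowDenom_rpow (by linarith) z).of_nonneg_of_le (fun _ ↦ norm_nonneg _)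
    (fun v ↦ norm_poincareTerm_le m s v z)

/-- `P_m(z, s)` IS the sum of its series for `s > 0` (not a junk `tsum`):
`HasSum (v ↦ ½ · poincareTerm N m s v z) (poincareHecke N m s z)`. [cite: IwaniecKowalski2004, §14.1 (14.4)] -/
theorem hasSum_poincareHecke (m : ℕ) {s : ℝ} (hs : 0 < s) (z : ℍ) :
    HasSum (fun v : Row N ↦ (1 / 2 : ℂ) * poincareTerm N m s v z) (poincareHecke N m s z) := by
  unfold poincareHecke
  exact (summable_norm_poincareTerm m hs z).of_norm.hasSum.mul_left _

/-- **A bound uniform in `m`:** `|P_m(z, s)| ≤ ½ Σ_{(c,d)=1, N∣c} |cz+d|^{−(2+2s)}` for `s > 0`.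
[cite: IwaniecKowalski2004, §14.1 (14.5)] -/
theorem norm_poincareHecke_le (m : ℕ) {s : ℝ} (hs : 0 < s) (z : ℍ) :
    ‖poincareHecke N m s z‖ ≤ 1 / 2 * ∑' v : Row N, ‖rowDenom v.1 z‖ ^ (-(2 + 2 * s)) := by
  unfold poincareHecke
  rw [norm_mul]
  have h12 : ‖(1 / 2 : ℂ)‖ = 1 / 2 := by norm_num
  rw [h12]
  gcongr
  exact (norm_tsum_le_tsum_norm (summable_norm_poincareTerm m hs z)).trans
    ((summable_norm_poincareTerm m hs z).tsum_le_tsum (fun v ↦ norm_poincareTerm_le m s v z)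
      (summable_norm_rowDenom_rpow (by linarith) z))

/-- `j_γ(z) = cz + d` in the row notation: `rowDenom (γ 1) z = denom γ z` (Mathlib's automorphy
factor), so that `poincareHecke_smul` reads `P_m(γz,s) = denom γ z ^ 2 · ‖denom γ z‖^{2s} · P_m(z,s)`.
[cite: IwaniecKowalski2004, §14.1 (14.4)] -/
theorem rowDenom_apply_one_eq_denom (γ : SL(2, ℤ)) (z : ℍ) :
    rowDenom ((γ : Matrix (Fin 2) (Fin 2) ℤ) 1) z = denom γ z := by
  rw [ModularGroup.denom_apply]; rfl

/-- Automorphy in Mathlib's `denom` currency: for `γ ∈ Γ₀(N)` and every real `s`,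
`P_m(γz, s) = denom γ z ^ 2 · ‖denom γ z‖^{2s} · P_m(z, s)`. [cite: IwaniecKowalski2004, §14.1 (14.4) with §3.2] -/
theorem poincareHecke_smul_denom (m : ℕ) (s : ℝ) (γ : SL(2, ℤ)) (hγ : γ ∈ Gamma0 N) (z : ℍ) :
    poincareHecke N m s (γ • z) =
      denom γ z ^ 2 * ((‖denom γ z‖ ^ (2 * s) : ℝ) : ℂ) * poincareHecke N m s z := by
  rw [← rowDenom_apply_one_eq_denom]; exact poincareHecke_smul m s γ hγ z

end Majorant

end Literature.NumberTheory.ModularForms.PoincareWeightTwo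

end
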